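import Summits.ABC.IUTFork.Repair.RHSigmaCellCreditExp
import Summits.ABC.IUTFork.Conditional.AbcExpOfCor312SlackContentDegOne
import HarnessLib

/-!
# R-H ROUND 3, abc-WITH-EXPONENT ENDS of the partial-credit door and of the least slack (degree one, transfer-free): «cell-level law with kept mass
# ≥ μ₀·M − Tol on the content locus ∧ hregC ⟹ c < C_ε·rad(abc)^{3/μ₀+ε} for EVERY abc triple, and abc with exponent 1/μ₀ on every far-from-cusps family»

abc-iut cell, rung LADDER-ABC:A2.RESCUE.H, R-H seat abc-iut-rh2-q2-eq (gen 3). PROOF-ONLY file (0 definitions, 0 `Prop` facts, no instance, no notation), the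
sequel of this seat's `RHSigmaCellCreditExp.lean` (p485439: `thm110LegendreWith_of_{cellCredit,weightedDeficit_nonpos,signedRemainder}_mu_content_hregC`),
composed BY NAME with abc-iut-rh2-q2-cond's degree-one ε-currency doors of `Conditional/AbcExpOfCor312SlackContentDegOne.lean` (p484277 / p484796, rh-lead
RULING R21 «F5(a) PRIMARY PATH = DEGREE ONE»): `Cor312Slack.abc_exp_three_div_of_cor312Slack_mu_content_hregC` ([NUMΣ-C] · [MU-C] · [CONE-C] ⟹ `c <
C·rad^{3/μ₀+ε'}` for ALL triples, abc-iut-rh2-xi-1's `abc_exp_of_dilatedDisplay_degOne`) and `Cor312Slack.ABCExpOn_farFromCusps_of_cor312Slack_mu_content_hregC_degOne`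
(⟹ `GenEll.ABCWithExponentOn {far from cusps} (1/μ₀)`, xi-1's `abcExpOn_farFromCusps_of_dilatedDisplay_degOne`), their [NUMΣ-C] binder DISCHARGED by this
seat's adapter (p484564) and doors (p484504). ROUND-3 START-HERE §2: the door a fraction-law candidate card names, all the way to the abc sentence.

WHAT IS TYPED (`0 < μ₀ ≤ 1`; `Tol(P,l) = Conditional.SigmaMass.tol P l`; CHOSEN realising ideles at every genuine Θ-volume datum `T`; `d(c)`/`t(c)` the cell
deficit / trivial cost of OUR typed hull; a DATUM-DEPENDENT weight `ω P l T : cells → ℝ`; content locus of abc-iut-C-cert-1; context binders `M … qData` VERBATIM):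
* **`abc_exp_three_div_of_cellCredit_mu_content_hregC`** — explicit 3 = [PC-C] «`d(c) ≤ (1 − ω(c))·t(c)` at every cell» · [MU-ω-C] `OffSigmaTolerance (1 − μ₀)
  (Tol(P,l)) T (PN Σᶠ (1−ω)·t)` (⟺ kept ω-mass `≥ μ₀·T.gap − Tol`) · [CONE-C] `hregC` VERBATIM, each ONLY on the content locus ⟹ for every `ε' > 0` there is
  `C > 0` with `c < C·rad(abc)^{3/μ₀ + ε'}` for EVERY abc triple.
* **`ABCExpOn_farFromCusps_of_cellCredit_mu_content_hregC_degOne`** — the same three binders ⟹ for every `0 < ρ ≤ 1/2`,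
  `GenEll.ABCWithExponentOn {P | P.FarFromCusps {2} ρ} (1/μ₀)` (abc with exponent `(1/μ₀)·(1+ε')` on every `ρ`-far family; no single family holds all triples, R19).
* **`abc_exp_three_div_of_signedRemainder_mu_content_hregC`**, **`ABCExpOn_farFromCusps_of_signedRemainder_mu_content_hregC_degOne`** — explicit 2 = [MU-D-C]
  «`D(T) = signedRemainder ≤ (1−μ₀)·T.gap + Tol(P,l)`» · [CONE-C], NO door hypothesis (the least slack is certified at every datum, `cor312UpTo_signedRemainder_chosen`):
  the sentence every weight / stratum / minorant device majorises.
The weighted (aggregate) twins are the one-line substitution `cor312UpTo_weightedTrivialMass_of_weightedDeficit_nonpos_chosen` for §1's lemma (not spelled out).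
HONEST FRAMING: CONDITIONAL; «the abc-type inequalities follow from these hypotheses AS TYPED», nothing more; [PC-C] / [MU-·-C] / [CONE-C] are ASSUMPTION LABELS,
never asserted, refutable datum by datum — with `ω = 1_{Σ₄}` (OUR typed licence alone) the kept fraction of deep data tends to `0` (SLICE.md: `j₀(w) ≈ slope/m_q`),
so [MU-ω-C] for a fixed `μ₀ > 0` is a hypothesis about the NEW cell-level input a round-3 candidate supplies, not a property of the typed hull; nothing here asserts
that abc (with any exponent) is proved or refuted, or that [IUTchIII] Cor. 3.12 / [IUTchIV] Thm. 1.10 holds or fails at any datum, or takes a side on any author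
(Mochizuki / Scholze–Stix / Joshi / Dupuy–Hilado); typed ≠ proved; instantiated ≠ endorsed. [claim: Mochizuki2012, status: disputed] for every IUT locution.
[cite: Mochizuki2012, IUTchIII Cor. 3.12 p. 173–174; IUTchIV Thm. 1.10 pp. 22–31, Cor. 2.2 (ii)–(iii) pp. 41–48] [cite: MochizukiGenEll2010, Thm 2.1 p.12]
-/

noncomputable section

open Set Function NumberField IsDedekindDomain

namespace Summit.ABC.IUTFork.Repair.RH.SigmaStrataEq

open Summit.ABC.IUTFork.Thm311 Summit.ABC.IUTFork.Thm311.Real Summit.ABC.IUTFork.Cor312 Summit.ABC.IUTFork.Cor312.Setting Summit.ABC.IUTFork.Cor312Vol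
  Summit.ABC.IUTFork.Cor312Prov Literature.IUT.LogThetaLattice Literature.IUT.LogVolume Literature.IUT.HodgeTheaters Literature.IUT.LogVolume.ThetaData
  Literature.NumberTheory.DiophantineGeometry Literature.NumberTheory.DiophantineGeometry.GenEll Summit.ABC.ABC.Theorems
  Summit.ABC.IUTFork.Repair.RH.SigmaLicence Summit.ABC.IUTFork.Repair.RH.SigmaMass Summit.ABC.IUTFork.Conditional

section Ends

variable
    (M : ∀ (P : NFPoint) (l : ℕ) (T : Cor22.ThetaVolumeDatumAt P l), Type) [∀ P l T, Field (M P l T)] [∀ P l T, NumberField (M P l T)]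
    (archPk : ∀ (P : NFPoint) (l : ℕ) (T : Cor22.ThetaVolumeDatumAt P l), letI := T.instFieldF; letI := T.instNumberFieldF; letI := T.instAlgebraF; letI := T.instFieldK;
        letI := T.instNumberFieldK; letI := T.instAlgebraK; letI := T.instFieldFbar; letI := T.instAlgebraFbar;
        letI := T.instAlgebraKFbar; letI := T.instIsElliptic;
      ∀ (j : (thetaIndex (pilotDataOfK T.D T.K)).Label) (vQ : (thetaIndex (pilotDataOfK T.D T.K)).VQ), Set ((logShellsDH (pilotDataOfK T.D T.K) (analyticLogv T.K)).Packet j vQ))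
    (archSub : ∀ (P : NFPoint) (l : ℕ) (T : Cor22.ThetaVolumeDatumAt P l), letI := T.instFieldF; letI := T.instNumberFieldF; letI := T.instAlgebraF; letI := T.instFieldK;
        letI := T.instNumberFieldK; letI := T.instAlgebraK; letI := T.instFieldFbar; letI := T.instAlgebraFbar;
        letI := T.instAlgebraKFbar; letI := T.instIsElliptic;
      ∀ (j : (thetaIndex (pilotDataOfK T.D T.K)).Label) (v : (thetaIndex (pilotDataOfK T.D T.K)).V), Set ((logShellsDH (pilotDataOfK T.D T.K) (analyticLogv T.K)).Packet j ((thetaIndex (pilotDataOfK T.D T.K)).over v)))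
    (Ψ : ∀ (P : NFPoint) (l : ℕ) (T : Cor22.ThetaVolumeDatumAt P l), letI := T.instFieldF; letI := T.instNumberFieldF; letI := T.instAlgebraF; letI := T.instFieldK;
        letI := T.instNumberFieldK; letI := T.instAlgebraK; letI := T.instFieldFbar; letI := T.instAlgebraFbar;
        letI := T.instAlgebraKFbar; letI := T.instIsElliptic;
      ℤ → ∀ v : (thetaIndex (pilotDataOfK T.D T.K)).V, v ∈ (thetaIndex (pilotDataOfK T.D T.K)).Vbad → Set ((logShellsDH (pilotDataOfK T.D T.K) (analyticLogv T.K)).StarPacket v))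
    (act : ∀ (P : NFPoint) (l : ℕ) (T : Cor22.ThetaVolumeDatumAt P l), letI := T.instFieldF; letI := T.instNumberFieldF; letI := T.instAlgebraF; letI := T.instFieldK;
        letI := T.instNumberFieldK; letI := T.instAlgebraK; letI := T.instFieldFbar; letI := T.instAlgebraFbar;
        letI := T.instAlgebraKFbar; letI := T.instIsElliptic;
      ℤ → ∀ v : (thetaIndex (pilotDataOfK T.D T.K)).V, v ∈ (thetaIndex (pilotDataOfK T.D T.K)).Vbad → (logShellsDH (pilotDataOfK T.D T.K) (analyticLogv T.K)).StarPacket v → Module.End ℚ ((logShellsDH (pilotDataOfK T.D T.K) (analyticLogv T.K)).StarPacket v))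
    (Mmod : ∀ (P : NFPoint) (l : ℕ) (T : Cor22.ThetaVolumeDatumAt P l), letI := T.instFieldF; letI := T.instNumberFieldF; letI := T.instAlgebraF; letI := T.instFieldK;
        letI := T.instNumberFieldK; letI := T.instAlgebraK; letI := T.instFieldFbar; letI := T.instAlgebraFbar;
        letI := T.instAlgebraKFbar; letI := T.instIsElliptic;
      ℤ → ∀ j : (thetaIndex (pilotDataOfK T.D T.K)).LabelStar, Set ((logShellsDH (pilotDataOfK T.D T.K) (analyticLogv T.K)).GlobalPacket j.1))
    (region : ∀ (P : NFPoint) (l : ℕ) (T : Cor22.ThetaVolumeDatumAt P l), letI := T.instFieldF; letI := T.instNumberFieldF; letI := T.instAlgebraF; letI := T.instFieldK;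
        letI := T.instNumberFieldK; letI := T.instAlgebraK; letI := T.instFieldFbar; letI := T.instAlgebraFbar;
        letI := T.instAlgebraKFbar; letI := T.instIsElliptic;
      ℤ → ∀ j : (thetaIndex (pilotDataOfK T.D T.K)).LabelStar, FinDivisor (M P l T) → ∀ vQ : (thetaIndex (pilotDataOfK T.D T.K)).VQ, Set ((logShellsDH (pilotDataOfK T.D T.K) (analyticLogv T.K)).Packet j.1 vQ))
    (n : ∀ (P : NFPoint) (l : ℕ) (T : Cor22.ThetaVolumeDatumAt P l), ℤ)
    {HT : ∀ (P : NFPoint) (l : ℕ) (T : Cor22.ThetaVolumeDatumAt P l), Type} {LogLink : ∀ (P : NFPoint) (l : ℕ) (T : Cor22.ThetaVolumeDatumAt P l), HT P l T → HT P l T → Type}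
    {IsFull : ∀ (P : NFPoint) (l : ℕ) (T : Cor22.ThetaVolumeDatumAt P l), ∀ {s t : HT P l T}, LogLink P l T s t → Prop}
    (lat : ∀ (P : NFPoint) (l : ℕ) (T : Cor22.ThetaVolumeDatumAt P l), LGPGaussianLogThetaLattice (LogLink P l T) (IsFull P l T))
    {Frd : ∀ (P : NFPoint) (l : ℕ) (T : Cor22.ThetaVolumeDatumAt P l), Type} {IsoF : ∀ (P : NFPoint) (l : ℕ) (T : Cor22.ThetaVolumeDatumAt P l), Frd P l T → Frd P l T → Type} {Ob : ∀ (P : NFPoint) (l : ℕ) (T : Cor22.ThetaVolumeDatumAt P l), Frd P l T → Type}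
    {realify : ∀ (P : NFPoint) (l : ℕ) (T : Cor22.ThetaVolumeDatumAt P l), Frd P l T → Frd P l T} {Strip : ∀ (P : NFPoint) (l : ℕ) (T : Cor22.ThetaVolumeDatumAt P l), Type} {IsoS : ∀ (P : NFPoint) (l : ℕ) (T : Cor22.ThetaVolumeDatumAt P l), Strip P l T → Strip P l T → Type}
    {Mv : ∀ (P : NFPoint) (l : ℕ) (T : Cor22.ThetaVolumeDatumAt P l), letI := T.instFieldF; letI := T.instNumberFieldF; letI := T.instAlgebraF; letI := T.instFieldK;
        letI := T.instNumberFieldK; letI := T.instAlgebraK; letI := T.instFieldFbar; letI := T.instAlgebraFbar;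
        letI := T.instAlgebraKFbar; letI := T.instIsElliptic;
      ∀ v : (thetaIndex (pilotDataOfK T.D T.K)).V, v ∈ (thetaIndex (pilotDataOfK T.D T.K)).Vbad → Type}
    [∀ P l T v h, Monoid (Mv P l T v h)]
    (sig : ∀ (P : NFPoint) (l : ℕ) (T : Cor22.ThetaVolumeDatumAt P l), letI := T.instFieldF; letI := T.instNumberFieldF; letI := T.instAlgebraF; letI := T.instFieldK;
        letI := T.instNumberFieldK; letI := T.instAlgebraK; letI := T.instFieldFbar; letI := T.instAlgebraFbar;
        letI := T.instAlgebraKFbar; letI := T.instIsElliptic;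
      GlobalLGPFrobenioidSignature (thetaIndex (pilotDataOfK T.D T.K)).lstar (thetaIndex (pilotDataOfK T.D T.K)).V (· ∈ (thetaIndex (pilotDataOfK T.D T.K)).Vbad) (Frd P l T) (IsoF P l T) (Ob P l T) (realify P l T)
        (Strip P l T) (IsoS P l T) (Mv P l T))
    (split : ∀ (P : NFPoint) (l : ℕ) (T : Cor22.ThetaVolumeDatumAt P l), SplittingMonoids (Mv P l T))
    {ObΔ : ∀ (P : NFPoint) (l : ℕ) (T : Cor22.ThetaVolumeDatumAt P l), Type} {N : ∀ (P : NFPoint) (l : ℕ) (T : Cor22.ThetaVolumeDatumAt P l), letI := T.instFieldF; letI := T.instNumberFieldF; letI := T.instAlgebraF; letI := T.instFieldK;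
        letI := T.instNumberFieldK; letI := T.instAlgebraK; letI := T.instFieldFbar; letI := T.instAlgebraFbar;
        letI := T.instAlgebraKFbar; letI := T.instIsElliptic;
      ∀ v : (thetaIndex (pilotDataOfK T.D T.K)).V, v ∈ (thetaIndex (pilotDataOfK T.D T.K)).Vbad → Type}
    [∀ P l T v h, Monoid (N P l T v h)] (qData : ∀ (P : NFPoint) (l : ℕ) (T : Cor22.ThetaVolumeDatumAt P l), QPilotData (ObΔ P l T) (N P l T))

include M archPk archSub Ψ act Mmod region n lat sig split qData

/-! ## §1. The partial-credit door to the abc sentences (degree one) -/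

/-- **`abc_exp_three_div_of_cellCredit_mu_content_hregC` — PARTIAL CREDIT ⟹ `c < C_ε·rad(abc)^{3/μ₀+ε}` FOR EVERY abc TRIPLE** (`0 < μ₀ ≤ 1`). Explicit 3 =
[PC-C] · [MU-ω-C] · [CONE-C] on the content locus (the binders of `thm110LegendreWith_of_cellCredit_mu_content_hregC` VERBATIM) ⟹ `∀ ε' > 0, ∃ C > 0`,
`c < C·rad(abc)^{3/μ₀ + ε'}` for all abc triples. abc-iut-rh2-q2-cond's `Cor312Slack.abc_exp_three_div_of_cor312Slack_mu_content_hregC` with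
`ε P l T := weightedTrivialMass … (ω P l T)`, [NUMΣ-C] DISCHARGED by `cor312UpTo_weightedTrivialMass_of_cellCredit_chosen`. CONDITIONAL; nothing is asserted about the
hypotheses; no side taken. [cite: Mochizuki2012, IUTchIV Thm. 1.10 pp. 22–31; Cor. 2.2 (ii)–(iii) pp. 41–48; IUTchIII Cor. 3.12 p. 174] [claim: Mochizuki2012, status: disputed] -/
theorem abc_exp_three_div_of_cellCredit_mu_content_hregC (μ₀ : ℝ) (hμ₀ : 0 < μ₀) (hμ₁ : μ₀ ≤ 1)
    (ω : ∀ (P : NFPoint) (l : ℕ) (T : Cor22.ThetaVolumeDatumAt P l), letI := T.instFieldF; letI := T.instNumberFieldF; letI := T.instAlgebraF; letI := T.instFieldK;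
        letI := T.instNumberFieldK; letI := T.instAlgebraK; letI := T.instFieldFbar; letI := T.instAlgebraFbar;
        letI := T.instAlgebraKFbar; letI := T.instIsElliptic;
      Fin (thetaIndex (pilotDataOfK T.D T.K)).lstar × (thetaIndex (pilotDataOfK T.D T.K)).VQ → ℝ)
    -- [PC-C] the candidate's CELL-LEVEL law at the chosen bed, demanded ONLY on the content locus
    (hPCC : ∀ P : NFPoint, P ∈ UP → ∀ l : ℕ, l.Prime → 5 ≤ l →
      Cor22.AdmitsCore P → Cor22.CondP2 P l → Cor22.CondP5 P l → Cor22.CondP6 P l →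
      6 * ((1 + 20 * (Cor22.dmod P : ℝ) / l) * (P.logDiff + Cor22.logCondAvoid P {2, l}))
          + 120 * (2 ^ 12 * 3 ^ 3 * 5 * (Cor22.dmod P : ℝ) * l) < Cor22.logQAvoid P {2, l} →
      ∀ T : Cor22.ThetaVolumeDatumAt P l, letI := T.instFieldF; letI := T.instNumberFieldF; letI := T.instAlgebraF; letI := T.instFieldK;
        letI := T.instNumberFieldK; letI := T.instAlgebraK; letI := T.instFieldFbar; letI := T.instAlgebraFbar;
        letI := T.instAlgebraKFbar; letI := T.instIsElliptic;
      ∀ c : Fin (thetaIndex (pilotDataOfK T.D T.K)).lstar × (thetaIndex (pilotDataOfK T.D T.K)).VQ,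
        cellDeficit
          (settingPrVolSharp (pilotDataOfK T.D T.K) (logvAnalytic_analyticLogv (F := T.K)) (M P l T) (archPk P l T) (archSub P l T) (Ψ P l T)
            (act P l T) (Mmod P l T) (region P l T) (n P l T) (lat P l T) (sig P l T) (split P l T) (qData P l T)
            (exists_realising_qIdeles_pilotDataOfK T.D).choose
            (exists_realising_thetaIdeles_pilotDataOfK T.D).choose
            (exists_realising_qIdeles_pilotDataOfK T.D).choose_spec.1
            (exists_realising_qIdeles_pilotDataOfK T.D).choose_spec.2.1) c.1 c.2 ≤
        (1 - ω P l T c) *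
          cellTrivialCost
            (settingPrVolSharp (pilotDataOfK T.D T.K) (logvAnalytic_analyticLogv (F := T.K)) (M P l T) (archPk P l T) (archSub P l T) (Ψ P l T)
            (act P l T) (Mmod P l T) (region P l T) (n P l T) (lat P l T) (sig P l T) (split P l T) (qData P l T)
            (exists_realising_qIdeles_pilotDataOfK T.D).choose
            (exists_realising_thetaIdeles_pilotDataOfK T.D).choose
            (exists_realising_qIdeles_pilotDataOfK T.D).choose_spec.1
            (exists_realising_qIdeles_pilotDataOfK T.D).choose_spec.2.1) c)
    -- [MU-ω-C] the charged mass is within the RELATIVE tolerance `(1 − μ₀)·T.gap + Tol(P,l)`, demanded ONLY there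
    (hMuC : ∀ P : NFPoint, P ∈ UP → ∀ l : ℕ, l.Prime → 5 ≤ l →
      Cor22.AdmitsCore P → Cor22.CondP2 P l → Cor22.CondP5 P l → Cor22.CondP6 P l →
      6 * ((1 + 20 * (Cor22.dmod P : ℝ) / l) * (P.logDiff + Cor22.logCondAvoid P {2, l}))
          + 120 * (2 ^ 12 * 3 ^ 3 * 5 * (Cor22.dmod P : ℝ) * l) < Cor22.logQAvoid P {2, l} →
      ∀ T : Cor22.ThetaVolumeDatumAt P l, letI := T.instFieldF; letI := T.instNumberFieldF; letI := T.instAlgebraF; letI := T.instFieldK;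
        letI := T.instNumberFieldK; letI := T.instAlgebraK; letI := T.instFieldFbar; letI := T.instAlgebraFbar;
        letI := T.instAlgebraKFbar; letI := T.instIsElliptic;
      RH.OffSigma.OffSigmaTolerance (1 - μ₀) (Conditional.SigmaMass.tol P l) T
        (weightedTrivialMass
          (settingPrVolSharp (pilotDataOfK T.D T.K) (logvAnalytic_analyticLogv (F := T.K)) (M P l T) (archPk P l T) (archSub P l T) (Ψ P l T)
            (act P l T) (Mmod P l T) (region P l T) (n P l T) (lat P l T) (sig P l T) (split P l T) (qData P l T)
            (exists_realising_qIdeles_pilotDataOfK T.D).choose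
            (exists_realising_thetaIdeles_pilotDataOfK T.D).choose
            (exists_realising_qIdeles_pilotDataOfK T.D).choose_spec.1
            (exists_realising_qIdeles_pilotDataOfK T.D).choose_spec.2.1) (ω P l T)))
    -- [CONE-C] abc-iut-C-cert-1's `hregC` VERBATIM (the off-regime hull estimate with print's `B_III(P,l)`, ONLY on the content locus)
    (hregC : ∀ P : NFPoint, P ∈ UP → ∀ l : ℕ, l.Prime → 5 ≤ l →
      Cor22.AdmitsCore P → Cor22.CondP2 P l → Cor22.CondP5 P l → Cor22.CondP6 P l →
      6 * ((1 + 20 * (Cor22.dmod P : ℝ) / l) * (P.logDiff + Cor22.logCondAvoid P {2, l}))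
          + 120 * (2 ^ 12 * 3 ^ 3 * 5 * (Cor22.dmod P : ℝ) * l) < Cor22.logQAvoid P {2, l} →
      ∀ T : Cor22.ThetaVolumeDatumAt P l,
        (letI := T.instFieldF; letI := T.instNumberFieldF; letI := T.instAlgebraF; letI := T.instFieldK
         letI := T.instNumberFieldK; letI := T.instAlgebraK; letI := T.instFieldFbar; letI := T.instAlgebraFbar
         letI := T.instAlgebraKFbar; letI := T.instIsElliptic
         ¬ (∀ p ∈ T.I.supportPrimes, ∀ v w : placesOver (fieldOfModuli T.E) p,
            (Summit.ABC.IUTFork.DHData.ofInput T.I).logQloc p v = (Summit.ABC.IUTFork.DHData.ofInput T.I).logQloc p w)) →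
        T.HullEstimateOf
          (((l : ℝ) + 1) / 4 *
            ((1 + 12 * (Cor22.dmod P : ℝ) / l) * (P.logDiff + Cor22.logCondAvoid P {2, l})
              + 2 * Real.log l + 52
              + 20 / 3 * Real.log (((2 ^ 12 * 3 ^ 3 * 5 * Cor22.dmod P : ℕ) : ℝ) * (l : ℝ))
                * (Nat.primeCounting (2 ^ 12 * 3 ^ 3 * 5 * Cor22.dmod P * l) : ℝ))))
    {ε' : ℝ} (hε' : 0 < ε') :
    ∃ C : ℝ, 0 < C ∧ ∀ a b c : ℕ, IsABCTriple a b c → (c : ℝ) < C * ((rad a b c : ℕ) : ℝ) ^ (3 / μ₀ + ε') :=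
  Cor312Slack.abc_exp_three_div_of_cor312Slack_mu_content_hregC μ₀ hμ₀ hμ₁
    (fun P l T => letI := T.instFieldF; letI := T.instNumberFieldF; letI := T.instAlgebraF; letI := T.instFieldK;
        letI := T.instNumberFieldK; letI := T.instAlgebraK; letI := T.instFieldFbar; letI := T.instAlgebraFbar;
        letI := T.instAlgebraKFbar; letI := T.instIsElliptic;
      weightedTrivialMass
        (settingPrVolSharp (pilotDataOfK T.D T.K) (logvAnalytic_analyticLogv (F := T.K)) (M P l T) (archPk P l T) (archSub P l T) (Ψ P l T)
            (act P l T) (Mmod P l T) (region P l T) (n P l T) (lat P l T) (sig P l T) (split P l T) (qData P l T)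
            (exists_realising_qIdeles_pilotDataOfK T.D).choose
            (exists_realising_thetaIdeles_pilotDataOfK T.D).choose
            (exists_realising_qIdeles_pilotDataOfK T.D).choose_spec.1
            (exists_realising_qIdeles_pilotDataOfK T.D).choose_spec.2.1) (ω P l T))
    (fun P hP l hl h5 hcore hP2 hP5 hP6 hct T =>
      cor312UpTo_weightedTrivialMass_of_cellCredit_chosen T (M P l T) (archPk P l T) (archSub P l T) (Ψ P l T) (act P l T) (Mmod P l T)
        (region P l T) (n P l T) (lat P l T) (sig P l T) (split P l T) (qData P l T) (ω P l T)
        (hPCC P hP l hl h5 hcore hP2 hP5 hP6 hct T))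
    hMuC hregC hε'

/-- **`ABCExpOn_farFromCusps_of_cellCredit_mu_content_hregC_degOne` — PARTIAL CREDIT ⟹ abc WITH EXPONENT `1/μ₀` ON EVERY FAR-FROM-CUSPS FAMILY** (`0 < μ₀ ≤ 1`).
[PC-C] · [MU-ω-C] · [CONE-C] on the content locus ⟹ for every `0 < ρ ≤ 1/2`, `GenEll.ABCWithExponentOn {P | P.FarFromCusps {2} ρ} (1/μ₀)`. abc-iut-rh2-q2-cond's
`Cor312Slack.ABCExpOn_farFromCusps_of_cor312Slack_mu_content_hregC_degOne` with `ε := PN Σᶠ (1−ω)·t`, [NUMΣ-C] DISCHARGED. CONDITIONAL; no side taken.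
[cite: Mochizuki2012, IUTchIV Thm. 1.10 pp. 22–31; Cor. 2.2 (ii)–(iii) pp. 41–48] [cite: MochizukiGenEll2010, Thm 2.1 p.12] [claim: Mochizuki2012, status: disputed] -/
theorem ABCExpOn_farFromCusps_of_cellCredit_mu_content_hregC_degOne (μ₀ : ℝ) (hμ₀ : 0 < μ₀) (hμ₁ : μ₀ ≤ 1)
    (ω : ∀ (P : NFPoint) (l : ℕ) (T : Cor22.ThetaVolumeDatumAt P l), letI := T.instFieldF; letI := T.instNumberFieldF; letI := T.instAlgebraF; letI := T.instFieldK;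
        letI := T.instNumberFieldK; letI := T.instAlgebraK; letI := T.instFieldFbar; letI := T.instAlgebraFbar;
        letI := T.instAlgebraKFbar; letI := T.instIsElliptic;
      Fin (thetaIndex (pilotDataOfK T.D T.K)).lstar × (thetaIndex (pilotDataOfK T.D T.K)).VQ → ℝ)
    -- [PC-C] the candidate's CELL-LEVEL law at the chosen bed, demanded ONLY on the content locus
    (hPCC : ∀ P : NFPoint, P ∈ UP → ∀ l : ℕ, l.Prime → 5 ≤ l →
      Cor22.AdmitsCore P → Cor22.CondP2 P l → Cor22.CondP5 P l → Cor22.CondP6 P l →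
      6 * ((1 + 20 * (Cor22.dmod P : ℝ) / l) * (P.logDiff + Cor22.logCondAvoid P {2, l}))
          + 120 * (2 ^ 12 * 3 ^ 3 * 5 * (Cor22.dmod P : ℝ) * l) < Cor22.logQAvoid P {2, l} →
      ∀ T : Cor22.ThetaVolumeDatumAt P l, letI := T.instFieldF; letI := T.instNumberFieldF; letI := T.instAlgebraF; letI := T.instFieldK;
        letI := T.instNumberFieldK; letI := T.instAlgebraK; letI := T.instFieldFbar; letI := T.instAlgebraFbar;
        letI := T.instAlgebraKFbar; letI := T.instIsElliptic;
      ∀ c : Fin (thetaIndex (pilotDataOfK T.D T.K)).lstar × (thetaIndex (pilotDataOfK T.D T.K)).VQ,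
        cellDeficit
          (settingPrVolSharp (pilotDataOfK T.D T.K) (logvAnalytic_analyticLogv (F := T.K)) (M P l T) (archPk P l T) (archSub P l T) (Ψ P l T)
            (act P l T) (Mmod P l T) (region P l T) (n P l T) (lat P l T) (sig P l T) (split P l T) (qData P l T)
            (exists_realising_qIdeles_pilotDataOfK T.D).choose
            (exists_realising_thetaIdeles_pilotDataOfK T.D).choose
            (exists_realising_qIdeles_pilotDataOfK T.D).choose_spec.1
            (exists_realising_qIdeles_pilotDataOfK T.D).choose_spec.2.1) c.1 c.2 ≤
        (1 - ω P l T c) *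
          cellTrivialCost
            (settingPrVolSharp (pilotDataOfK T.D T.K) (logvAnalytic_analyticLogv (F := T.K)) (M P l T) (archPk P l T) (archSub P l T) (Ψ P l T)
            (act P l T) (Mmod P l T) (region P l T) (n P l T) (lat P l T) (sig P l T) (split P l T) (qData P l T)
            (exists_realising_qIdeles_pilotDataOfK T.D).choose
            (exists_realising_thetaIdeles_pilotDataOfK T.D).choose
            (exists_realising_qIdeles_pilotDataOfK T.D).choose_spec.1
            (exists_realising_qIdeles_pilotDataOfK T.D).choose_spec.2.1) c)
    -- [MU-ω-C] the charged mass is within the RELATIVE tolerance `(1 − μ₀)·T.gap + Tol(P,l)`, demanded ONLY there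
    (hMuC : ∀ P : NFPoint, P ∈ UP → ∀ l : ℕ, l.Prime → 5 ≤ l →
      Cor22.AdmitsCore P → Cor22.CondP2 P l → Cor22.CondP5 P l → Cor22.CondP6 P l →
      6 * ((1 + 20 * (Cor22.dmod P : ℝ) / l) * (P.logDiff + Cor22.logCondAvoid P {2, l}))
          + 120 * (2 ^ 12 * 3 ^ 3 * 5 * (Cor22.dmod P : ℝ) * l) < Cor22.logQAvoid P {2, l} →
      ∀ T : Cor22.ThetaVolumeDatumAt P l, letI := T.instFieldF; letI := T.instNumberFieldF; letI := T.instAlgebraF; letI := T.instFieldK;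
        letI := T.instNumberFieldK; letI := T.instAlgebraK; letI := T.instFieldFbar; letI := T.instAlgebraFbar;
        letI := T.instAlgebraKFbar; letI := T.instIsElliptic;
      RH.OffSigma.OffSigmaTolerance (1 - μ₀) (Conditional.SigmaMass.tol P l) T
        (weightedTrivialMass
          (settingPrVolSharp (pilotDataOfK T.D T.K) (logvAnalytic_analyticLogv (F := T.K)) (M P l T) (archPk P l T) (archSub P l T) (Ψ P l T)
            (act P l T) (Mmod P l T) (region P l T) (n P l T) (lat P l T) (sig P l T) (split P l T) (qData P l T)
            (exists_realising_qIdeles_pilotDataOfK T.D).choose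
            (exists_realising_thetaIdeles_pilotDataOfK T.D).choose
            (exists_realising_qIdeles_pilotDataOfK T.D).choose_spec.1
            (exists_realising_qIdeles_pilotDataOfK T.D).choose_spec.2.1) (ω P l T)))
    -- [CONE-C] abc-iut-C-cert-1's `hregC` VERBATIM (the off-regime hull estimate with print's `B_III(P,l)`, ONLY on the content locus)
    (hregC : ∀ P : NFPoint, P ∈ UP → ∀ l : ℕ, l.Prime → 5 ≤ l →
      Cor22.AdmitsCore P → Cor22.CondP2 P l → Cor22.CondP5 P l → Cor22.CondP6 P l →
      6 * ((1 + 20 * (Cor22.dmod P : ℝ) / l) * (P.logDiff + Cor22.logCondAvoid P {2, l}))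
          + 120 * (2 ^ 12 * 3 ^ 3 * 5 * (Cor22.dmod P : ℝ) * l) < Cor22.logQAvoid P {2, l} →
      ∀ T : Cor22.ThetaVolumeDatumAt P l,
        (letI := T.instFieldF; letI := T.instNumberFieldF; letI := T.instAlgebraF; letI := T.instFieldK
         letI := T.instNumberFieldK; letI := T.instAlgebraK; letI := T.instFieldFbar; letI := T.instAlgebraFbar
         letI := T.instAlgebraKFbar; letI := T.instIsElliptic
         ¬ (∀ p ∈ T.I.supportPrimes, ∀ v w : placesOver (fieldOfModuli T.E) p,
            (Summit.ABC.IUTFork.DHData.ofInput T.I).logQloc p v = (Summit.ABC.IUTFork.DHData.ofInput T.I).logQloc p w)) →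
        T.HullEstimateOf
          (((l : ℝ) + 1) / 4 *
            ((1 + 12 * (Cor22.dmod P : ℝ) / l) * (P.logDiff + Cor22.logCondAvoid P {2, l})
              + 2 * Real.log l + 52
              + 20 / 3 * Real.log (((2 ^ 12 * 3 ^ 3 * 5 * Cor22.dmod P : ℕ) : ℝ) * (l : ℝ))
                * (Nat.primeCounting (2 ^ 12 * 3 ^ 3 * 5 * Cor22.dmod P * l) : ℝ))))
    {ρ : ℝ} (h0 : 0 < ρ) (h2 : ρ ≤ 1 / 2) :
    ABCWithExponentOn {P : NFPoint | P.FarFromCusps ({2} : Finset ℕ) ρ} (1 / μ₀) :=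
  Cor312Slack.ABCExpOn_farFromCusps_of_cor312Slack_mu_content_hregC_degOne μ₀ hμ₀ hμ₁
    (fun P l T => letI := T.instFieldF; letI := T.instNumberFieldF; letI := T.instAlgebraF; letI := T.instFieldK;
        letI := T.instNumberFieldK; letI := T.instAlgebraK; letI := T.instFieldFbar; letI := T.instAlgebraFbar;
        letI := T.instAlgebraKFbar; letI := T.instIsElliptic;
      weightedTrivialMass
        (settingPrVolSharp (pilotDataOfK T.D T.K) (logvAnalytic_analyticLogv (F := T.K)) (M P l T) (archPk P l T) (archSub P l T) (Ψ P l T)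
            (act P l T) (Mmod P l T) (region P l T) (n P l T) (lat P l T) (sig P l T) (split P l T) (qData P l T)
            (exists_realising_qIdeles_pilotDataOfK T.D).choose
            (exists_realising_thetaIdeles_pilotDataOfK T.D).choose
            (exists_realising_qIdeles_pilotDataOfK T.D).choose_spec.1
            (exists_realising_qIdeles_pilotDataOfK T.D).choose_spec.2.1) (ω P l T))
    (fun P hP l hl h5 hcore hP2 hP5 hP6 hct T =>
      cor312UpTo_weightedTrivialMass_of_cellCredit_chosen T (M P l T) (archPk P l T) (archSub P l T) (Ψ P l T) (act P l T) (Mmod P l T)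
        (region P l T) (n P l T) (lat P l T) (sig P l T) (split P l T) (qData P l T) (ω P l T)
        (hPCC P hP l hl h5 hcore hP2 hP5 hP6 hct T))
    hMuC hregC h0 h2

/-! ## §2. The least slack to the abc sentences (degree one): no door hypothesis -/

/-- **`abc_exp_three_div_of_signedRemainder_mu_content_hregC` — THE LEAST SLACK ⟹ `c < C_ε·rad(abc)^{3/μ₀+ε}` FOR EVERY abc TRIPLE** (`0 < μ₀ ≤ 1`). Explicit 2 =
[MU-D-C] «`OffSigmaTolerance (1 − μ₀) (Tol(P,l)) T (D(T))`, `D(T) = signedRemainder … = R_∅(T) − C(T)`» on the content locus · [CONE-C] `hregC` VERBATIM ⟹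
`∀ ε' > 0, ∃ C > 0, c < C·rad(abc)^{3/μ₀ + ε'}` for all abc triples; [NUMΣ-C] DISCHARGED hypothesis-free by `cor312UpTo_signedRemainder_chosen`. CONDITIONAL;
[MU-D-C] is an assumption label on a DEFINED datum number; no side taken. [cite: Mochizuki2012, IUTchIV Thm. 1.10 pp. 22–31; Cor. 2.2 (ii)–(iii) pp. 41–48;
IUTchIII Cor. 3.12 p. 174] [claim: Mochizuki2012, status: disputed] -/
theorem abc_exp_three_div_of_signedRemainder_mu_content_hregC (μ₀ : ℝ) (hμ₀ : 0 < μ₀) (hμ₁ : μ₀ ≤ 1)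
    -- [MU-D-C] the signed remainder is within the RELATIVE tolerance `(1 − μ₀)·T.gap + Tol(P,l)`, demanded ONLY on the content locus
    (hMuDC : ∀ P : NFPoint, P ∈ UP → ∀ l : ℕ, l.Prime → 5 ≤ l →
      Cor22.AdmitsCore P → Cor22.CondP2 P l → Cor22.CondP5 P l → Cor22.CondP6 P l →
      6 * ((1 + 20 * (Cor22.dmod P : ℝ) / l) * (P.logDiff + Cor22.logCondAvoid P {2, l}))
          + 120 * (2 ^ 12 * 3 ^ 3 * 5 * (Cor22.dmod P : ℝ) * l) < Cor22.logQAvoid P {2, l} →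
      ∀ T : Cor22.ThetaVolumeDatumAt P l, letI := T.instFieldF; letI := T.instNumberFieldF; letI := T.instAlgebraF; letI := T.instFieldK;
        letI := T.instNumberFieldK; letI := T.instAlgebraK; letI := T.instFieldFbar; letI := T.instAlgebraFbar;
        letI := T.instAlgebraKFbar; letI := T.instIsElliptic;
      RH.OffSigma.OffSigmaTolerance (1 - μ₀) (Conditional.SigmaMass.tol P l) T
        (signedRemainder
          (settingPrVolSharp (pilotDataOfK T.D T.K) (logvAnalytic_analyticLogv (F := T.K)) (M P l T) (archPk P l T) (archSub P l T) (Ψ P l T)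
            (act P l T) (Mmod P l T) (region P l T) (n P l T) (lat P l T) (sig P l T) (split P l T) (qData P l T)
            (exists_realising_qIdeles_pilotDataOfK T.D).choose
            (exists_realising_thetaIdeles_pilotDataOfK T.D).choose
            (exists_realising_qIdeles_pilotDataOfK T.D).choose_spec.1
            (exists_realising_qIdeles_pilotDataOfK T.D).choose_spec.2.1)))
    -- [CONE-C] abc-iut-C-cert-1's `hregC` VERBATIM (the off-regime hull estimate with print's `B_III(P,l)`, ONLY on the content locus)
    (hregC : ∀ P : NFPoint, P ∈ UP → ∀ l : ℕ, l.Prime → 5 ≤ l →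
      Cor22.AdmitsCore P → Cor22.CondP2 P l → Cor22.CondP5 P l → Cor22.CondP6 P l →
      6 * ((1 + 20 * (Cor22.dmod P : ℝ) / l) * (P.logDiff + Cor22.logCondAvoid P {2, l}))
          + 120 * (2 ^ 12 * 3 ^ 3 * 5 * (Cor22.dmod P : ℝ) * l) < Cor22.logQAvoid P {2, l} →
      ∀ T : Cor22.ThetaVolumeDatumAt P l,
        (letI := T.instFieldF; letI := T.instNumberFieldF; letI := T.instAlgebraF; letI := T.instFieldK
         letI := T.instNumberFieldK; letI := T.instAlgebraK; letI := T.instFieldFbar; letI := T.instAlgebraFbar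
         letI := T.instAlgebraKFbar; letI := T.instIsElliptic
         ¬ (∀ p ∈ T.I.supportPrimes, ∀ v w : placesOver (fieldOfModuli T.E) p,
            (Summit.ABC.IUTFork.DHData.ofInput T.I).logQloc p v = (Summit.ABC.IUTFork.DHData.ofInput T.I).logQloc p w)) →
        T.HullEstimateOf
          (((l : ℝ) + 1) / 4 *
            ((1 + 12 * (Cor22.dmod P : ℝ) / l) * (P.logDiff + Cor22.logCondAvoid P {2, l})
              + 2 * Real.log l + 52
              + 20 / 3 * Real.log (((2 ^ 12 * 3 ^ 3 * 5 * Cor22.dmod P : ℕ) : ℝ) * (l : ℝ))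
                * (Nat.primeCounting (2 ^ 12 * 3 ^ 3 * 5 * Cor22.dmod P * l) : ℝ))))
    {ε' : ℝ} (hε' : 0 < ε') :
    ∃ C : ℝ, 0 < C ∧ ∀ a b c : ℕ, IsABCTriple a b c → (c : ℝ) < C * ((rad a b c : ℕ) : ℝ) ^ (3 / μ₀ + ε') :=
  Cor312Slack.abc_exp_three_div_of_cor312Slack_mu_content_hregC μ₀ hμ₀ hμ₁
    (fun P l T => letI := T.instFieldF; letI := T.instNumberFieldF; letI := T.instAlgebraF; letI := T.instFieldK;
        letI := T.instNumberFieldK; letI := T.instAlgebraK; letI := T.instFieldFbar; letI := T.instAlgebraFbar;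
        letI := T.instAlgebraKFbar; letI := T.instIsElliptic;
      signedRemainder
        (settingPrVolSharp (pilotDataOfK T.D T.K) (logvAnalytic_analyticLogv (F := T.K)) (M P l T) (archPk P l T) (archSub P l T) (Ψ P l T)
            (act P l T) (Mmod P l T) (region P l T) (n P l T) (lat P l T) (sig P l T) (split P l T) (qData P l T)
            (exists_realising_qIdeles_pilotDataOfK T.D).choose
            (exists_realising_thetaIdeles_pilotDataOfK T.D).choose
            (exists_realising_qIdeles_pilotDataOfK T.D).choose_spec.1
            (exists_realising_qIdeles_pilotDataOfK T.D).choose_spec.2.1))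
    (fun P _ l _ _ _ _ _ _ _ T =>
      cor312UpTo_signedRemainder_chosen T (M P l T) (archPk P l T) (archSub P l T) (Ψ P l T) (act P l T) (Mmod P l T)
        (region P l T) (n P l T) (lat P l T) (sig P l T) (split P l T) (qData P l T))
    hMuDC hregC hε'

/-- **`ABCExpOn_farFromCusps_of_signedRemainder_mu_content_hregC_degOne` — THE LEAST SLACK ⟹ abc WITH EXPONENT `1/μ₀` ON EVERY FAR-FROM-CUSPS FAMILY**
(`0 < μ₀ ≤ 1`). [MU-D-C] · [CONE-C] on the content locus ⟹ for every `0 < ρ ≤ 1/2`, `GenEll.ABCWithExponentOn {P | P.FarFromCusps {2} ρ} (1/μ₀)`; [NUMΣ-C]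
DISCHARGED by `cor312UpTo_signedRemainder_chosen`. CONDITIONAL; no side taken. [cite: Mochizuki2012, IUTchIV Thm. 1.10 pp. 22–31; Cor. 2.2 (ii)–(iii) pp. 41–48]
[cite: MochizukiGenEll2010, Thm 2.1 p.12] [claim: Mochizuki2012, status: disputed] -/
theorem ABCExpOn_farFromCusps_of_signedRemainder_mu_content_hregC_degOne (μ₀ : ℝ) (hμ₀ : 0 < μ₀) (hμ₁ : μ₀ ≤ 1)
    -- [MU-D-C] the signed remainder is within the RELATIVE tolerance `(1 − μ₀)·T.gap + Tol(P,l)`, demanded ONLY on the content locus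
    (hMuDC : ∀ P : NFPoint, P ∈ UP → ∀ l : ℕ, l.Prime → 5 ≤ l →
      Cor22.AdmitsCore P → Cor22.CondP2 P l → Cor22.CondP5 P l → Cor22.CondP6 P l →
      6 * ((1 + 20 * (Cor22.dmod P : ℝ) / l) * (P.logDiff + Cor22.logCondAvoid P {2, l}))
          + 120 * (2 ^ 12 * 3 ^ 3 * 5 * (Cor22.dmod P : ℝ) * l) < Cor22.logQAvoid P {2, l} →
      ∀ T : Cor22.ThetaVolumeDatumAt P l, letI := T.instFieldF; letI := T.instNumberFieldF; letI := T.instAlgebraF; letI := T.instFieldK;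
        letI := T.instNumberFieldK; letI := T.instAlgebraK; letI := T.instFieldFbar; letI := T.instAlgebraFbar;
        letI := T.instAlgebraKFbar; letI := T.instIsElliptic;
      RH.OffSigma.OffSigmaTolerance (1 - μ₀) (Conditional.SigmaMass.tol P l) T
        (signedRemainder
          (settingPrVolSharp (pilotDataOfK T.D T.K) (logvAnalytic_analyticLogv (F := T.K)) (M P l T) (archPk P l T) (archSub P l T) (Ψ P l T)
            (act P l T) (Mmod P l T) (region P l T) (n P l T) (lat P l T) (sig P l T) (split P l T) (qData P l T)
            (exists_realising_qIdeles_pilotDataOfK T.D).choose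
            (exists_realising_thetaIdeles_pilotDataOfK T.D).choose
            (exists_realising_qIdeles_pilotDataOfK T.D).choose_spec.1
            (exists_realising_qIdeles_pilotDataOfK T.D).choose_spec.2.1)))
    -- [CONE-C] abc-iut-C-cert-1's `hregC` VERBATIM (the off-regime hull estimate with print's `B_III(P,l)`, ONLY on the content locus)
    (hregC : ∀ P : NFPoint, P ∈ UP → ∀ l : ℕ, l.Prime → 5 ≤ l →
      Cor22.AdmitsCore P → Cor22.CondP2 P l → Cor22.CondP5 P l → Cor22.CondP6 P l →
      6 * ((1 + 20 * (Cor22.dmod P : ℝ) / l) * (P.logDiff + Cor22.logCondAvoid P {2, l}))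
          + 120 * (2 ^ 12 * 3 ^ 3 * 5 * (Cor22.dmod P : ℝ) * l) < Cor22.logQAvoid P {2, l} →
      ∀ T : Cor22.ThetaVolumeDatumAt P l,
        (letI := T.instFieldF; letI := T.instNumberFieldF; letI := T.instAlgebraF; letI := T.instFieldK
         letI := T.instNumberFieldK; letI := T.instAlgebraK; letI := T.instFieldFbar; letI := T.instAlgebraFbar
         letI := T.instAlgebraKFbar; letI := T.instIsElliptic
         ¬ (∀ p ∈ T.I.supportPrimes, ∀ v w : placesOver (fieldOfModuli T.E) p,
            (Summit.ABC.IUTFork.DHData.ofInput T.I).logQloc p v = (Summit.ABC.IUTFork.DHData.ofInput T.I).logQloc p w)) →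
        T.HullEstimateOf
          (((l : ℝ) + 1) / 4 *
            ((1 + 12 * (Cor22.dmod P : ℝ) / l) * (P.logDiff + Cor22.logCondAvoid P {2, l})
              + 2 * Real.log l + 52
              + 20 / 3 * Real.log (((2 ^ 12 * 3 ^ 3 * 5 * Cor22.dmod P : ℕ) : ℝ) * (l : ℝ))
                * (Nat.primeCounting (2 ^ 12 * 3 ^ 3 * 5 * Cor22.dmod P * l) : ℝ))))
    {ρ : ℝ} (h0 : 0 < ρ) (h2 : ρ ≤ 1 / 2) :
    ABCWithExponentOn {P : NFPoint | P.FarFromCusps ({2} : Finset ℕ) ρ} (1 / μ₀) :=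
  Cor312Slack.ABCExpOn_farFromCusps_of_cor312Slack_mu_content_hregC_degOne μ₀ hμ₀ hμ₁
    (fun P l T => letI := T.instFieldF; letI := T.instNumberFieldF; letI := T.instAlgebraF; letI := T.instFieldK;
        letI := T.instNumberFieldK; letI := T.instAlgebraK; letI := T.instFieldFbar; letI := T.instAlgebraFbar;
        letI := T.instAlgebraKFbar; letI := T.instIsElliptic;
      signedRemainder
        (settingPrVolSharp (pilotDataOfK T.D T.K) (logvAnalytic_analyticLogv (F := T.K)) (M P l T) (archPk P l T) (archSub P l T) (Ψ P l T)
            (act P l T) (Mmod P l T) (region P l T) (n P l T) (lat P l T) (sig P l T) (split P l T) (qData P l T)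
            (exists_realising_qIdeles_pilotDataOfK T.D).choose
            (exists_realising_thetaIdeles_pilotDataOfK T.D).choose
            (exists_realising_qIdeles_pilotDataOfK T.D).choose_spec.1
            (exists_realising_qIdeles_pilotDataOfK T.D).choose_spec.2.1))
    (fun P _ l _ _ _ _ _ _ _ T =>
      cor312UpTo_signedRemainder_chosen T (M P l T) (archPk P l T) (archSub P l T) (Ψ P l T) (act P l T) (Mmod P l T)
        (region P l T) (n P l T) (lat P l T) (sig P l T) (split P l T) (qData P l T))
    hMuDC hregC h0 h2

end Ends

end Summit.ABC.IUTFork.Repair.RH.SigmaStrataEq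
end
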